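import Mathlib.MeasureTheory.Integral.DominatedConvergence
import Mathlib.MeasureTheory.Integral.IntervalIntegral.FundThmCalculus
import Summits.QuantumFields.BalabanUV.Beta.EriceFlowEnclosureCesaroTauberianRate
import Summits.QuantumFields.BalabanUV.Beta.EriceFlowEnclosureCesaroTauberian

/-!
# Beta / EriceFlowEnclosureCesaroHigherOrder — THE (C,1) DATUM IS CANONICAL: FOR A BOUNDED FUNCTION EVERY HIGHER CESÀRO ORDER GIVES
# THE SAME DATUM, AND EACH AVERAGING COSTS EXACTLY A SQUARE ROOT IN THE RATE (pure [folklore] SERVICE for P2 #52c ∕ #52d; Mathlib +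
# P2 #50d `…CesaroTauberian` + P2 #51a `…CesaroTauberianRate` only).
# For φ : ]0, δ] → ℝ interval-integrable with **|φ| ≤ C** and its Cesàro mean `M t := (1∕t)∫₀ᵗ φ`:
#   * M is bounded by C and is AUTOMATICALLY **2C-log-Lipschitz**: `|M u − M t| ≤ 2C(1 − t∕u) ≤ 2C·log(u∕t)` (`cesaro_window_le`,
#     `cesaro_logLip`) — the Cesàro mean of a bounded function is in the TAUBERIAN CLASS of row L109 with NO hypothesis on φ;
#   * hence **the (C,2) datum is the (C,1) datum**: `(1∕t)∫₀ᵗ M → m ⟺ M t → m` at 0⁺ (`cesaro_of_cesaro2`, `cesaro2_iff_cesaro`; ⟸ Abelian,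
#     no clause) — iterating, every Hölder mean `H_{k+1} = (1∕t)∫₀ᵗ H_k` has the same datum (each H_k is again bounded by C);
#   * WITH RATES each averaging costs a square root (row L112 on M): (C,2) rate E ⟹ **`|M t − m| ≤ 4√(CE) + E`**
#     (`cesaro_rate_of_cesaro2_rate`), (C,2) rate `A s^γ` ⟹ (C,1) rate `(2C + 3·2^γ A)·t^(γ∕2)` (`cesaro_power_rate_of_cesaro2_power_rate`),
#     the Abelian direction keeps the rate (`cesaro2_rate_of_cesaro_rate`);
#   * two levels down, in the Tauberian class: (C,2) datum + φ slowly oscillating ⟹ φ → m (`tendsto_of_cesaro2_slowlyOscillating`,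
#     `cesaro2_iff_tendsto_of_slowlyOscillating`), and for K-log-Lipschitz φ a (C,2) rate `A s^γ` gives `|φ t − m| ≤ C′·t^(γ∕4)` — TWO HALVINGS
#     (`power_rate_of_cesaro2_power_rate`).
# SHARP (P2 #52b): φ_W = (3∕2)√t·cos((√t)⁻¹) + (1∕2)sin((√t)⁻¹) = (t·V)′ is bounded by 2, its Cesàro mean IS gen 34's V = √t·cos((√t)⁻¹)
# (not o(√t)), its (C,2) mean is ≤ 6t: (C,2) exponent 1, (C,1) exponent exactly 1∕2 — and φ_W has NO limit at all.
# (β-flow team, prover 2 = lower ∕ positivity side, unit `b2b-balaban-beta-bflow-p2`, gen 35; module P2 #52a; no Erice sentence occurs)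

HONEST FRAMING (page 1 of everything the β sub-cell writes): discharging `BetaPertH` makes Bałaban's UV stability UNCONDITIONAL — a
real constructive-QFT result; it is NOT the continuum limit and NOT the Clay problem.  HONEST DEPENDENCY (cell reorg 2026-08-19,
verbatim): «continuum YM on T⁴ ⇐ BetaPertH ∧ nine spine estimates (0/9 proved); BetaPertH ⇐ (D1) ∧ (D4) ∧ CAP+tail; G-an2-4 gates
asym, D1 and NE2/3/4.»  THIS MODULE DISCHARGES NOTHING and quotes nothing: [folklore] real analysis about one bounded real function φ
(the equivalence of the Cesàro ∕ Hölder means of all orders for bounded functions — the continuous analogue at 0⁺ of the classical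
Knopp–Schnee equivalence `(H,k) ~ (C,k)` and of the Tauberian step «(C,k+1) + slow oscillation ⟹ (C,k)», G. H. Hardy, Divergent
Series (1949), Chs. V–VII — obtained here from P2 #50d's Schmidt-type theorem because the Cesàro mean of a bounded function is slowly
oscillating; the rate statements are P2 #51a's square-root law applied to M; `lean search "Hölder mean|HolderMean|cesaro.*order"`:
nothing in Mathlib or the project).

THE POINT.  `M u − M t = (∫ₜᵘ φ)∕u − (∫₀ᵗ φ)·(u − t)∕(tu)`, both pieces are ≤ C(u − t)∕u in modulus, and `1 − t∕u ≤ log(u∕t)`.  So M is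
2C-log-Lipschitz — slowly oscillating — and continuous on ]0, δ], with `∫₀ˢ M` differentiable (FTC); row L109
(`tendsto_of_cesaro_slowlyOscillating`) and row L112 (`sqrt_law`, `power_rate`, `cesaro_rate_of_rate`) apply to the pair (∫₀ M, M)
VERBATIM.  Nothing else is used.

WHAT THIS FILE PROVES (0 sorry, 0 def): §1 `integral_abs_le`, `const_nonneg`, `cesaro_abs_le`, **`cesaro_window_le`**, **`cesaro_logLip`**,
`primitive_continuousOn`, `cesaro_continuousOn`, `cesaro_integrableOn`, `cesaro_intervalIntegrable`, `cesaro_primitive_hasDerivAt`,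
`cesaro_slowlyOscillating`, `cesaro2_abs_le`; §2 HEADLINE **`cesaro_of_cesaro2`**, `cesaro2_of_cesaro`, **`cesaro2_iff_cesaro`**; §3
**`cesaro_rate_of_cesaro2_rate`**, **`cesaro_power_rate_of_cesaro2_power_rate`**, `cesaro2_rate_of_cesaro_rate`; §4
`tendsto_of_cesaro2_slowlyOscillating`, `cesaro2_iff_tendsto_of_slowlyOscillating`, **`power_rate_of_cesaro2_power_rate`**.
NOT CLAIMED: Riesz typical means of non-integer order; Abel ∕ logarithmic means (a Karamata-type theorem would be needed); unbounded φ
(for φ = log the means of all orders diverge together); anything about β-functions (the consumer P2 #52c instantiates φ = r∕u², C = C₂);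
`BetaPertH`; continuum; Clay.
-/

namespace Summit.QuantumFields.BalabanUV.Beta.EriceFlowEnclosureCesaroHigherOrder

open Set Filter Topology MeasureTheory
open Summit.QuantumFields.BalabanUV.Beta.EriceFlowEnclosureCesaroTauberianRate (sqrt_law power_rate cesaro_rate_of_rate)
open Summit.QuantumFields.BalabanUV.Beta.EriceFlowEnclosureCesaroTauberian
  (tendsto_of_cesaro_slowlyOscillating slowlyOscillating_of_logLip)
open Summit.QuantumFields.BalabanUV.Beta.EriceFlowEnclosureSlowVariationC1 (cesaro_of_tendsto)

noncomputable section

variable {φ : ℝ → ℝ} {δ C : ℝ}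

/-! ## §1 The Cesàro mean of a bounded function: bounded by C, 2C-log-Lipschitz, continuous, with the FTC for its own primitive -/

/-- `|∫ₐᵇ φ| ≤ C·(b − a)` for `0 ≤ a ≤ b ≤ δ` when `|φ| ≤ C` on ]0, δ]. [folklore] -/
theorem integral_abs_le (hb : ∀ v ∈ Ioc 0 δ, |φ v| ≤ C) {a b : ℝ} (ha : 0 ≤ a) (hab : a ≤ b) (hbδ : b ≤ δ) :
    |∫ v in a..b, φ v| ≤ C * (b - a) := by
  have h := intervalIntegral.norm_integral_le_of_norm_le_const (a := a) (b := b) (C := C) (f := φ)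
    fun v hv => by
      rw [uIoc_of_le hab] at hv
      rw [Real.norm_eq_abs]
      exact hb v ⟨ha.trans_lt hv.1, hv.2.trans hbδ⟩
  rw [Real.norm_eq_abs, abs_of_nonneg (sub_nonneg.mpr hab)] at h
  exact h

/-- The bound is nonnegative (δ > 0). [folklore] -/
theorem const_nonneg (hδ : 0 < δ) (hb : ∀ v ∈ Ioc 0 δ, |φ v| ≤ C) : 0 ≤ C :=
  (abs_nonneg _).trans (hb δ ⟨hδ, le_rfl⟩)

/-- **The Cesàro mean of a function bounded by C is bounded by C**: `|(1∕t)∫₀ᵗ φ| ≤ C` on ]0, δ]. [folklore] -/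
theorem cesaro_abs_le (hb : ∀ v ∈ Ioc 0 δ, |φ v| ≤ C) {t : ℝ} (ht : t ∈ Ioc 0 δ) :
    |(∫ v in (0:ℝ)..t, φ v) / t| ≤ C := by
  rw [abs_div, abs_of_pos ht.1, div_le_iff₀ ht.1]
  have h := integral_abs_le hb le_rfl ht.1.le ht.2
  rw [sub_zero] at h
  exact h

/-- **THE WINDOW ESTIMATE**: for `0 < t ≤ u ≤ δ`, `|M u − M t| ≤ 2C·(1 − t∕u)` where `M s = (1∕s)∫₀ˢ φ`
(`M u − M t = (∫ₜᵘ φ)∕u − (∫₀ᵗ φ)(u − t)∕(tu)`, each piece ≤ C(u − t)∕u). [folklore] -/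
theorem cesaro_window_le (hint : ∀ t ∈ Ioc 0 δ, IntervalIntegrable φ volume 0 t)
    (hb : ∀ v ∈ Ioc 0 δ, |φ v| ≤ C) {t u : ℝ} (ht : 0 < t) (htu : t ≤ u) (hu : u ≤ δ) :
    |(∫ v in (0:ℝ)..u, φ v) / u - (∫ v in (0:ℝ)..t, φ v) / t| ≤ 2 * C * (1 - t / u) := by
  have hu0 : 0 < u := ht.trans_le htu
  have hIt := hint t ⟨ht, htu.trans hu⟩
  have hIu := hint u ⟨hu0, hu⟩
  have hItu : IntervalIntegrable φ volume t u := hIt.symm.trans hIu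
  have hsplit : ∫ v in (0:ℝ)..u, φ v = (∫ v in (0:ℝ)..t, φ v) + ∫ v in t..u, φ v :=
    (intervalIntegral.integral_add_adjacent_intervals hIt hItu).symm
  have h1 : |∫ v in (0:ℝ)..t, φ v| ≤ C * t := by
    have h := integral_abs_le hb le_rfl ht.le (htu.trans hu)
    rw [sub_zero] at h
    exact h
  have h2 : |∫ v in t..u, φ v| ≤ C * (u - t) := integral_abs_le hb ht.le htu hu
  have hk : 0 ≤ (u - t) / (t * u) := div_nonneg (sub_nonneg.mpr htu) (mul_pos ht hu0).le
  have e : (∫ v in (0:ℝ)..u, φ v) / u - (∫ v in (0:ℝ)..t, φ v) / t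
      = (∫ v in t..u, φ v) / u - (∫ v in (0:ℝ)..t, φ v) * ((u - t) / (t * u)) := by
    rw [hsplit]
    field_simp
    ring
  rw [e]
  calc |(∫ v in t..u, φ v) / u - (∫ v in (0:ℝ)..t, φ v) * ((u - t) / (t * u))|
      ≤ |(∫ v in t..u, φ v) / u| + |(∫ v in (0:ℝ)..t, φ v) * ((u - t) / (t * u))| := abs_sub _ _
    _ = |∫ v in t..u, φ v| / u + |∫ v in (0:ℝ)..t, φ v| * ((u - t) / (t * u)) := by
        rw [abs_div, abs_of_pos hu0, abs_mul, abs_of_nonneg hk]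
    _ ≤ C * (u - t) / u + C * t * ((u - t) / (t * u)) :=
        add_le_add (div_le_div_of_nonneg_right h2 hu0.le) (mul_le_mul_of_nonneg_right h1 hk)
    _ = 2 * C * (1 - t / u) := by
        field_simp
        ring

/-- **THE CESÀRO MEAN OF A BOUNDED FUNCTION IS 2C-LOG-LIPSCHITZ** (row L112's modulus shape): for `0 < t ≤ u < δ`,
`|M u − M t| ≤ 2C·log(u∕t)` (`1 − t∕u ≤ log(u∕t)`). No hypothesis on φ beyond the bound. [folklore] -/
theorem cesaro_logLip (hint : ∀ t ∈ Ioc 0 δ, IntervalIntegrable φ volume 0 t)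
    (hb : ∀ v ∈ Ioc 0 δ, |φ v| ≤ C) : ∀ t u : ℝ, 0 < t → t ≤ u → u < δ →
    |(∫ v in (0:ℝ)..u, φ v) / u - (∫ v in (0:ℝ)..t, φ v) / t| ≤ (2 * C) * Real.log (u / t) := by
  intro t u ht htu hu
  have hu0 : 0 < u := ht.trans_le htu
  have hC : 0 ≤ C := (abs_nonneg _).trans (hb u ⟨hu0, hu.le⟩)
  have h := cesaro_window_le hint hb ht htu hu.le
  have hlog : 1 - t / u ≤ Real.log (u / t) := by
    have h' := Real.one_sub_inv_le_log_of_pos (div_pos hu0 ht)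
    rwa [inv_div] at h'
  calc _ ≤ 2 * C * (1 - t / u) := h
    _ ≤ (2 * C) * Real.log (u / t) := mul_le_mul_of_nonneg_left hlog (by positivity)

/-- The primitive `s ↦ ∫₀ˢ φ` is continuous on [0, δ]. [folklore] -/
theorem primitive_continuousOn (hδ : 0 < δ) (hint : ∀ t ∈ Ioc 0 δ, IntervalIntegrable φ volume 0 t) :
    ContinuousOn (fun s => ∫ v in (0:ℝ)..s, φ v) (Icc 0 δ) := by
  have hc := intervalIntegral.continuousOn_primitive_interval' (hint δ ⟨hδ, le_rfl⟩) left_mem_uIcc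
  rwa [uIcc_of_le hδ.le] at hc

/-- The Cesàro mean `s ↦ (1∕s)∫₀ˢ φ` is continuous on ]0, δ]. [folklore] -/
theorem cesaro_continuousOn (hδ : 0 < δ) (hint : ∀ t ∈ Ioc 0 δ, IntervalIntegrable φ volume 0 t) :
    ContinuousOn (fun s => (∫ v in (0:ℝ)..s, φ v) / s) (Ioc 0 δ) :=
  ((primitive_continuousOn hδ hint).mono Ioc_subset_Icc_self).div continuousOn_id fun _ hs => hs.1.ne'

/-- The Cesàro mean is integrable on ]0, δ] (continuous and bounded by C there). [folklore] -/
theorem cesaro_integrableOn (hδ : 0 < δ) (hint : ∀ t ∈ Ioc 0 δ, IntervalIntegrable φ volume 0 t)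
    (hb : ∀ v ∈ Ioc 0 δ, |φ v| ≤ C) :
    IntegrableOn (fun s => (∫ v in (0:ℝ)..s, φ v) / s) (Ioc 0 δ) := by
  have hconst : IntegrableOn (fun _ : ℝ => C) (Ioc (0 : ℝ) δ) := integrableOn_const (hs := measure_Ioc_lt_top.ne)
  refine Integrable.mono' hconst ((cesaro_continuousOn hδ hint).aestronglyMeasurable measurableSet_Ioc) ?_
  refine ae_restrict_of_forall_mem measurableSet_Ioc fun v hv => ?_
  rw [Real.norm_eq_abs]
  exact cesaro_abs_le hb hv

/-- The Cesàro mean is interval-integrable on [0, t] for every `t ∈ ]0, δ]`. [folklore] -/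
theorem cesaro_intervalIntegrable (hδ : 0 < δ) (hint : ∀ t ∈ Ioc 0 δ, IntervalIntegrable φ volume 0 t)
    (hb : ∀ v ∈ Ioc 0 δ, |φ v| ≤ C) :
    ∀ t ∈ Ioc 0 δ, IntervalIntegrable (fun s => (∫ v in (0:ℝ)..s, φ v) / s) volume 0 t := by
  intro t ht
  rw [intervalIntegrable_iff, uIoc_of_le ht.1.le]
  exact (cesaro_integrableOn hδ hint hb).mono_set (Ioc_subset_Ioc_right ht.2)

/-- **FTC for the second primitive**: `s ↦ ∫₀ˢ M` has derivative `M t` at every `t ∈ ]0, δ[`. [folklore] -/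
theorem cesaro_primitive_hasDerivAt (hδ : 0 < δ) (hint : ∀ t ∈ Ioc 0 δ, IntervalIntegrable φ volume 0 t)
    (hb : ∀ v ∈ Ioc 0 δ, |φ v| ≤ C) : ∀ t ∈ Ioo 0 δ,
    HasDerivAt (fun s => ∫ v in (0:ℝ)..s, (∫ w in (0:ℝ)..v, φ w) / v) ((∫ w in (0:ℝ)..t, φ w) / t) t := by
  intro t ht
  have hI := cesaro_intervalIntegrable hδ hint hb t ⟨ht.1, ht.2.le⟩
  have hMcont : ContinuousOn (fun s => (∫ v in (0:ℝ)..s, φ v) / s) (Ioo 0 δ) :=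
    (cesaro_continuousOn hδ hint).mono Ioo_subset_Ioc_self
  have hmeas : StronglyMeasurableAtFilter (fun s => (∫ v in (0:ℝ)..s, φ v) / s) (𝓝 t) volume :=
    hMcont.stronglyMeasurableAtFilter isOpen_Ioo t ht
  have hcs : ContinuousAt (fun s => (∫ v in (0:ℝ)..s, φ v) / s) t :=
    hMcont.continuousAt (Ioo_mem_nhds ht.1 ht.2)
  exact intervalIntegral.integral_hasDerivAt_right hI hmeas hcs

/-- **The Cesàro mean of a bounded function is SLOWLY OSCILLATING at 0⁺** (row L109's Tauberian class), with no hypothesis on φ.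
[folklore] -/
theorem cesaro_slowlyOscillating (hδ : 0 < δ) (hint : ∀ t ∈ Ioc 0 δ, IntervalIntegrable φ volume 0 t)
    (hb : ∀ v ∈ Ioc 0 δ, |φ v| ≤ C) : ∀ ε > 0, ∃ q > (1:ℝ), ∃ τ > (0:ℝ), ∀ t ∈ Ioc 0 τ, ∀ u ∈ Icc t (q * t),
    |(∫ v in (0:ℝ)..u, φ v) / u - (∫ v in (0:ℝ)..t, φ v) / t| ≤ ε := by
  have hC := const_nonneg hδ hb
  refine slowlyOscillating_of_logLip (K := 2 * C + 1) (by positivity) hδ fun t u ht htu hu => ?_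
  have h := cesaro_logLip hint hb t u ht htu hu
  have hlog : 0 ≤ Real.log (u / t) := Real.log_nonneg ((one_le_div ht).mpr htu)
  nlinarith

/-- The (C,2) mean is again bounded by C (so every Hölder mean is, by iteration). [folklore] -/
theorem cesaro2_abs_le (hb : ∀ v ∈ Ioc 0 δ, |φ v| ≤ C) {t : ℝ} (ht : t ∈ Ioc 0 δ) :
    |(∫ v in (0:ℝ)..t, (∫ w in (0:ℝ)..v, φ w) / v) / t| ≤ C :=
  cesaro_abs_le (φ := fun s => (∫ v in (0:ℝ)..s, φ v) / s) (fun _ hv => cesaro_abs_le hb hv) ht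

/-! ## §2 The (C,2) datum is the (C,1) datum — no clause (HEADLINE) -/

/-- **(C,2) ⟹ (C,1) FOR A BOUNDED FUNCTION, NO CLAUSE (HEADLINE).**  If φ is interval-integrable with `|φ| ≤ C` on ]0, δ] and its
(C,2) mean converges, `(1∕t)∫₀ᵗ M → m` at 0⁺ (`M v = (1∕v)∫₀ᵛ φ`), then **`M t → m` at 0⁺**: M is slowly oscillating (§1), so row L109's
Tauberian theorem applies to the pair (∫₀ M, M).  The continuous analogue at 0⁺ of the classical «(C,2) + boundedness ⟹ (C,1)» step for
sequences (Hardy, Divergent Series, Chs. VI–VII shape). [folklore] -/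
theorem cesaro_of_cesaro2 (hδ : 0 < δ) (hint : ∀ t ∈ Ioc 0 δ, IntervalIntegrable φ volume 0 t)
    (hb : ∀ v ∈ Ioc 0 δ, |φ v| ≤ C) {m : ℝ}
    (h2 : Tendsto (fun t => (∫ v in (0:ℝ)..t, (∫ w in (0:ℝ)..v, φ w) / v) / t) (𝓝[>] 0) (𝓝 m)) :
    Tendsto (fun t => (∫ w in (0:ℝ)..t, φ w) / t) (𝓝[>] 0) (𝓝 m) :=
  tendsto_of_cesaro_slowlyOscillating hδ (cesaro_primitive_hasDerivAt hδ hint hb) h2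
    (cesaro_slowlyOscillating hδ hint hb)

/-- The Abelian direction (C,1) ⟹ (C,2), no clause (P2 #47c `cesaro_of_tendsto` on M). [folklore] -/
theorem cesaro2_of_cesaro (hδ : 0 < δ) (hint : ∀ t ∈ Ioc 0 δ, IntervalIntegrable φ volume 0 t)
    (hb : ∀ v ∈ Ioc 0 δ, |φ v| ≤ C) {m : ℝ}
    (h1 : Tendsto (fun t => (∫ w in (0:ℝ)..t, φ w) / t) (𝓝[>] 0) (𝓝 m)) :
    Tendsto (fun t => (∫ v in (0:ℝ)..t, (∫ w in (0:ℝ)..v, φ w) / v) / t) (𝓝[>] 0) (𝓝 m) :=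
  cesaro_of_tendsto hδ (cesaro_intervalIntegrable hδ hint hb) h1

/-- **THE (C,2) AND (C,1) DATA OF A BOUNDED FUNCTION COINCIDE** (both directions; no clause). [folklore] -/
theorem cesaro2_iff_cesaro (hδ : 0 < δ) (hint : ∀ t ∈ Ioc 0 δ, IntervalIntegrable φ volume 0 t)
    (hb : ∀ v ∈ Ioc 0 δ, |φ v| ≤ C) (m : ℝ) :
    Tendsto (fun t => (∫ v in (0:ℝ)..t, (∫ w in (0:ℝ)..v, φ w) / v) / t) (𝓝[>] 0) (𝓝 m) ↔
      Tendsto (fun t => (∫ w in (0:ℝ)..t, φ w) / t) (𝓝[>] 0) (𝓝 m) :=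
  ⟨cesaro_of_cesaro2 hδ hint hb, cesaro2_of_cesaro hδ hint hb⟩

/-! ## §3 Rates: each averaging costs a square root (row L112 applied to M) -/

/-- **A (C,2) RATE GIVES A (C,1) RATE — THE SQUARE-ROOT LAW FOR ONE AVERAGING**: if `|(1∕s)∫₀ˢ M − m| ≤ E` on ]0, τ] (E > 0, C > 0)
then **`|M t − m| ≤ 4√(C·E) + E`** whenever `(1 + √(E∕C))·t ≤ τ` and `< δ` (row L112's `sqrt_law` with K = 2C). [folklore] -/
theorem cesaro_rate_of_cesaro2_rate (hδ : 0 < δ) (hint : ∀ t ∈ Ioc 0 δ, IntervalIntegrable φ volume 0 t)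
    (hb : ∀ v ∈ Ioc 0 δ, |φ v| ≤ C) (hC : 0 < C) {τ E m : ℝ}
    (hE : ∀ s ∈ Ioc 0 τ, |(∫ v in (0:ℝ)..s, (∫ w in (0:ℝ)..v, φ w) / v) / s - m| ≤ E) (hE0 : 0 < E)
    {t : ℝ} (ht : 0 < t) (hhτ : (1 + Real.sqrt (E / C)) * t ≤ τ) (hhδ : (1 + Real.sqrt (E / C)) * t < δ) :
    |(∫ w in (0:ℝ)..t, φ w) / t - m| ≤ 4 * Real.sqrt (C * E) + E := by
  have e1 : 2 * E / (2 * C) = E / C := mul_div_mul_left _ _ two_ne_zero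
  have h := sqrt_law (K := 2 * C) (τ := τ) (m := m) (E := E) (cesaro_primitive_hasDerivAt hδ hint hb)
    (by positivity) (cesaro_logLip hint hb) hE hE0 ht (by rwa [e1]) (by rwa [e1])
  have e2 : Real.sqrt (2 * (2 * C) * E) = 2 * Real.sqrt (C * E) := by
    rw [show 2 * (2 * C) * E = 2 ^ 2 * (C * E) by ring, Real.sqrt_mul (by positivity), Real.sqrt_sq zero_le_two]
  rw [e2] at h
  linarith

/-- **POWER RATES — ONE HALVING PER AVERAGING**: a (C,2) rate `A·s^γ` on ]0, τ] gives the (C,1) rate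
`|M t − m| ≤ (2C + 3·2^γ·A)·t^(γ∕2)` on ]0, min 1 (τ∕2) (δ∕4)] (row L112's `power_rate` with K = 2C). [folklore] -/
theorem cesaro_power_rate_of_cesaro2_power_rate (hδ : 0 < δ) (hint : ∀ t ∈ Ioc 0 δ, IntervalIntegrable φ volume 0 t)
    (hb : ∀ v ∈ Ioc 0 δ, |φ v| ≤ C) {τ A γ m : ℝ} (hA : 0 ≤ A) (hγ : 0 < γ)
    (hE : ∀ s ∈ Ioc 0 τ, |(∫ v in (0:ℝ)..s, (∫ w in (0:ℝ)..v, φ w) / v) / s - m| ≤ A * s ^ γ) :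
    ∀ t ∈ Ioc 0 (min 1 (min (τ / 2) (δ / 4))),
      |(∫ w in (0:ℝ)..t, φ w) / t - m| ≤ (2 * C + 3 * 2 ^ γ * A) * t ^ (γ / 2) := by
  have hC := const_nonneg hδ hb
  exact power_rate (cesaro_primitive_hasDerivAt hδ hint hb) (by positivity) (cesaro_logLip hint hb) hA hγ hE

/-- The Abelian direction keeps the rate: `|M s − m| ≤ ε s` (ε monotone on ]0, δ]) ⟹ `|(1∕t)∫₀ᵗ M − m| ≤ ε t` (row L112's
`cesaro_rate_of_rate` on M). [folklore] -/
theorem cesaro2_rate_of_cesaro_rate (hδ : 0 < δ) (hint : ∀ t ∈ Ioc 0 δ, IntervalIntegrable φ volume 0 t)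
    (hb : ∀ v ∈ Ioc 0 δ, |φ v| ≤ C) {ε : ℝ → ℝ} {m : ℝ} (hε : MonotoneOn ε (Ioc 0 δ))
    (hr : ∀ s ∈ Ioc 0 δ, |(∫ w in (0:ℝ)..s, φ w) / s - m| ≤ ε s) :
    ∀ t ∈ Ioc 0 δ, |(∫ v in (0:ℝ)..t, (∫ w in (0:ℝ)..v, φ w) / v) / t - m| ≤ ε t :=
  cesaro_rate_of_rate (cesaro_intervalIntegrable hδ hint hb) hε hr

/-! ## §4 Two levels down: in the Tauberian class the (C,2) datum is the limit of φ, with two halvings -/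

/-- **(C,2) DATUM + SLOW OSCILLATION OF φ ⟹ φ CONVERGES**: row L109 twice (once on M with no clause, once on φ with its clause).
[folklore] -/
theorem tendsto_of_cesaro2_slowlyOscillating (hδ : 0 < δ) (hint : ∀ t ∈ Ioc 0 δ, IntervalIntegrable φ volume 0 t)
    (hb : ∀ v ∈ Ioc 0 δ, |φ v| ≤ C)
    (hFTC : ∀ t ∈ Ioo 0 δ, HasDerivAt (fun s => ∫ v in (0:ℝ)..s, φ v) (φ t) t)
    (hso : ∀ ε > 0, ∃ q > (1:ℝ), ∃ τ > (0:ℝ), ∀ t ∈ Ioc 0 τ, ∀ u ∈ Icc t (q * t), |φ u - φ t| ≤ ε) {m : ℝ}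
    (h2 : Tendsto (fun t => (∫ v in (0:ℝ)..t, (∫ w in (0:ℝ)..v, φ w) / v) / t) (𝓝[>] 0) (𝓝 m)) :
    Tendsto φ (𝓝[>] 0) (𝓝 m) :=
  tendsto_of_cesaro_slowlyOscillating hδ hFTC (cesaro_of_cesaro2 hδ hint hb h2) hso

/-- **IN THE TAUBERIAN CLASS ALL THREE DATA AGREE**: for bounded slowly oscillating φ with the FTC, `(C,2) mean → m ⟺ φ → m`
(and ⟺ `(C,1) mean → m` by §2). [folklore] -/
theorem cesaro2_iff_tendsto_of_slowlyOscillating (hδ : 0 < δ) (hint : ∀ t ∈ Ioc 0 δ, IntervalIntegrable φ volume 0 t)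
    (hb : ∀ v ∈ Ioc 0 δ, |φ v| ≤ C)
    (hFTC : ∀ t ∈ Ioo 0 δ, HasDerivAt (fun s => ∫ v in (0:ℝ)..s, φ v) (φ t) t)
    (hso : ∀ ε > 0, ∃ q > (1:ℝ), ∃ τ > (0:ℝ), ∀ t ∈ Ioc 0 τ, ∀ u ∈ Icc t (q * t), |φ u - φ t| ≤ ε) (m : ℝ) :
    Tendsto (fun t => (∫ v in (0:ℝ)..t, (∫ w in (0:ℝ)..v, φ w) / v) / t) (𝓝[>] 0) (𝓝 m) ↔
      Tendsto φ (𝓝[>] 0) (𝓝 m) :=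
  ⟨tendsto_of_cesaro2_slowlyOscillating hδ hint hb hFTC hso,
    fun h => cesaro2_of_cesaro hδ hint hb (cesaro_of_tendsto hδ hint h)⟩

/-- **TWO HALVINGS**: φ bounded by C and K-log-Lipschitz with the FTC, and a (C,2) rate `A·s^γ` on ]0, τ] ⟹
`|φ t − m| ≤ (K + 3·2^(γ∕2)·(2C + 3·2^γ·A))·t^(γ∕4)` on an explicit chart (row L112's `power_rate` after §3). [folklore] -/
theorem power_rate_of_cesaro2_power_rate (hδ : 0 < δ) (hint : ∀ t ∈ Ioc 0 δ, IntervalIntegrable φ volume 0 t)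
    (hb : ∀ v ∈ Ioc 0 δ, |φ v| ≤ C) {K : ℝ} (hK : 0 ≤ K)
    (hFTC : ∀ t ∈ Ioo 0 δ, HasDerivAt (fun s => ∫ v in (0:ℝ)..s, φ v) (φ t) t)
    (hlip : ∀ t u : ℝ, 0 < t → t ≤ u → u < δ → |φ u - φ t| ≤ K * Real.log (u / t))
    {τ A γ m : ℝ} (hA : 0 ≤ A) (hγ : 0 < γ)
    (hE : ∀ s ∈ Ioc 0 τ, |(∫ v in (0:ℝ)..s, (∫ w in (0:ℝ)..v, φ w) / v) / s - m| ≤ A * s ^ γ) :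
    ∀ t ∈ Ioc 0 (min 1 (min ((min 1 (min (τ / 2) (δ / 4))) / 2) (δ / 4))),
      |φ t - m| ≤ (K + 3 * 2 ^ (γ / 2) * (2 * C + 3 * 2 ^ γ * A)) * t ^ (γ / 4) := by
  have hC := const_nonneg hδ hb
  have h1 := cesaro_power_rate_of_cesaro2_power_rate hδ hint hb hA hγ hE
  have h2 := power_rate (τ := min 1 (min (τ / 2) (δ / 4))) (A := 2 * C + 3 * 2 ^ γ * A) (γ := γ / 2) (m := m)
    hFTC hK hlip (by positivity) (by positivity) h1
  intro t ht
  have h := h2 t ht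
  rwa [show γ / 2 / 2 = γ / 4 by ring] at h

end

end Summit.QuantumFields.BalabanUV.Beta.EriceFlowEnclosureCesaroHigherOrder
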